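import Summits.MatrixMultiplication.MatrixMultiplication.Theorems.LevelGradedCohnUmansGradedDesignFamilyStubSubfieldCellModPDuals
import Summits.MatrixMultiplication.MatrixMultiplication.Theorems.LevelGradedCohnUmansGradedDesignFamilyStubSubfieldCellModPDualsBridge
import Summits.MatrixMultiplication.MatrixMultiplication.Theorems.LevelGradedCohnUmansGradedDesignFamilyStubSubfieldCellTwentyfiveDualsN0
import Summits.MatrixMultiplication.MatrixMultiplication.Theorems.LevelGradedCohnUmansGradedDesignFamilyStubSubfieldCellTwentyfiveDualsN1
import Summits.MatrixMultiplication.MatrixMultiplication.Theorems.LevelGradedCohnUmansGradedDesignFamilyStubSubfieldCellTwentyfiveDualsN2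
import Summits.MatrixMultiplication.MatrixMultiplication.Theorems.LevelGradedCohnUmansGradedDesignFamilyStubSubfieldCellTwentyfiveDualsN3
import Summits.MatrixMultiplication.MatrixMultiplication.Theorems.LevelGradedCohnUmansGradedDesignFamilyStubSubfieldCellTwentyfiveDualsN4

/-!
# A TRUE finite instance of the subfield-cell clause of `stub_subfieldCell` at `|K| = 25`: `(|Y|, |Z|) = (1, 103)`

Route `LevelGradedCohnUmans`, crux `GradedDesignFamily` (stmt-MatrixMultiplication-7610), registered line
`Cruxes/GradedDesignFamily/Lines/quadratic_extension_level_one_cell.lean`, stub S3 `stub_subfieldCell` (the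
"subfield cell" `GL₂(𝔽_{q²}) ⊃ SL₂(𝔽_q)`), here `q = 5`.

HONEST FRAMING.  The stub is ASYMPTOTIC and this file decides nothing about it.  It belongs to a compiler-checked
TRUE finite instance of the stub's INNER CLAUSE — an injective `φ : SL₂(k) →* GL₂(K)` with `|K| = |k|²` and finite
`Y, Z ⊆ GL₂(K)` such that every `z₀ ∈ Z` has a frame function `F(g) = ∑_u cf u (g u)` with
`F(φ(a)·y·y'⁻¹·z) = [a = 1][y = y'][z = z₀]` — with `|K| = 25`, `|Y| = 1`, `|Z| = 103` (volume
`|SL₂(𝔽₅)|·|Y|·|Z| = 12360`, min(|Y|,|Z|) = 1) — the ROW-ONE design `Y = {1}`,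
`|Z| = 103`: `|Y| + |Z| = 104` ATTAINS the cell's exact counting wall `|Y| + |Z| ≤ 104` (SUBFIELD.md §2; COMPUTATION-grade:
the cuspidal layer `(d, m) = (4, 414)` of the level-one frame module gives `16·(|Y| + |Z| − 1) ≤ 4·414`, the two
half-cuspidal layers `(2, 208)` give the same), one below the LANDED relation-free Lean wall `subfieldCell_twentyfive_wall`
(`|Y| + |Z| ≤ 105`, `Negative/SubfieldCellTwentyfiveCubes.lean`): the maximum of `|Y| + |Z|` over the `q = 5` cell is now
pinned to `{104, 105}` by theorems (`104` by computation); the analogues are `(1,19)` at `q = 3` (`subfieldCell_nine_witnessE`)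
and `(1,50)` at `q = 4` (`subfieldCell_sixteen_witnessE`, gen 14).  The cell's balanced records `(12,16)`
(`subfieldCell_twentyfive_witnessM`, volume 23040), `(12,15)` `…witnessL`, `(12,14)` `…witnessK`, `(12,12)` `…witnessJ`,
`(10,10)` `…witnessH` and the exponent-3 ceiling `Negative/SubfieldCellTwentyfiveCubes.lean` are untouched.  VALUE = CERTIFICATE / THEOREM, NOT summit progress.

CERTIFICATE FORMAT (MOD-`p` EQUIVARIANT DUALS, `p = 2`; gen 6 introduced it at `|K| = 16`).  The files prove that the 0/1
evaluation system of the design — rows = the 12360 points `φ(SL₂ 𝔽₅)·(Y Y⁻¹ Z)` (103 cosets of `φ(SL₂ 𝔽₅)`: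
0 garbage + 103 target), columns = (line representative `u`, vector `v`) — has FULL ROW RANK modulo `2`:
for one representative `r_c` of every coset a frame table `b_c` over `ZMod 2` on the 26 line representatives
is exhibited whose evaluations on all 12360 points are `[g = r_c]` (the duals of the other points are the
`φ(SL₂ 𝔽₅)`-translates `b_c(u, h⁻¹v)`); `subfieldCell_pack_modp` turns this into rational frame separators for
every target (independence mod `p` ⇒ over `ℚ` ⇒ full row rank ⇒ solvable) and the clause.  (An exact rational
certificate of a `10 × 10` design at `q = 5` would need thousands of bits per entry; the mod-`p` tables need 1.)

DATA.  `k = 𝔽₅ = ZMod 5`, `K = 𝔽₂₅ = QuadraticAlgebra (ZMod 5) 2 0` (`i² = 2`), elements `⟨re, im⟩ = re + im·i`,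
`code(e) = re + 5·im`; `φ = Matrix.SpecialLinearGroup.mapGL K` (entrywise `algebraMap`); `SL₂(𝔽₅)` listed explicitly
(120 matrices, identity first, then lexicographic); `Y`, `Z` and the coset representatives `r_c` (minimal code in their
coset; garbage cosets first, then the targets' cosets in `Z` order) are explicit units, each with its inverse
(`SL₂(𝔽₅)` and the 103 representatives as `List`s read with `getD`) —
here `Y = {1}` (ROW ONE: `W = Y Y⁻¹ ∖ {1} = ∅`, so a separated design is just a list of pairwise distinct target cosets
`φ(SL₂ 𝔽₅)·z_l` in whose evaluation system every target point is a coloop; all 103 cosets of the point set are target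
cosets, 0 garbage, and `z_l = r_l` is the minimal-code element of its coset) and `Z` = the representatives of 103 of the
3120 cosets of `φ(SL₂ 𝔽₅)` in `GL₂(𝔽₂₅)` found by gen 14's `rowone.py` (unit b2b-lgcu-subfield-g14: randomized greedy
over the cosets, seed 1 — a coset is accepted iff its 120 evaluation rows are independent mod 2 of the rows accepted
before; 103 of the first 104 random cosets passed (49 s of pure Python), i.e. wall-attaining row-one designs are generic
at `q = 5`); certificate `rowone_q5_1x103_p2_s1.json` (sha256 `081f4e09fba03317…`), archived with the search code under
`run/shared/lean/b2b/levelgraded-cu/b2b-lgcu-subfield-g14/`.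
Table `b_c(u_t, v) = (n_c >>> (1·(625·t + code₂ v))) mod 2^1` read in `ZMod 2` (ONE natural number `n_c` per table),
`code₂ v = 25·code(v 0) + code(v 1)`, `u_t = (1, x_t)` (`t = code x_t < 25`), `u_25 = (0, 1)`; 636680 non-zero entries
in all.  The tables are
the mod-2 equivariant duals of that certificate: Gaussian elimination of the `12360 × 16250` evaluation matrix over `𝔽₂`
(full row rank 12360; 2.6·10⁷ row operations, 40 s of pure Python on the hub) and back-substitution for the 103 unit
right-hand sides at the representatives, every one of the `103 · 12360` identities re-verified in exact integer
arithmetic before generation.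

LEAN.  The five design objects (`SL₂(𝔽₅)` list, coset representatives, line representatives, `Y`, `Z`) are plain
`def`s in data file 0 and the dual tables of block `j` a plain `def` in data file `j`, so that every statement and the
assembly refer to the SAME constants (re-stated big literals make the elaborator's unifier blow up — gen-6 measurement).
The dual identities of a block are ONE `native_decide` (axiom `Lean.ofReduceBool`; the tables are the explicit witness),
decided as the vanishing of the compiled residual `modpDualResidual b_c S M ↑r_c` at the plain matrix
`M = (h : Matrix).map (algebraMap 𝔽₅ K) * ↑r_c'` (entries bound once, frame vectors written out) and converted pointwise
to the unit form of `subfieldCell_pack_modp` by `modpDual_point_of_residual`; exhaustiveness of the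
`SL₂(𝔽₅)` list, the coset cover (explicit index tables) and the subfield test behind target well-formedness
(`subfieldCell_hwf_of_subfieldTest`) are one `native_decide` each, injectivity and the inverse identities kernel
`decide` (injectivity of a long `Z` given as a `List.getD` look-up: `native_decide`); the assembly is a term-mode application of the wrapper `subfieldCell_twentyfive_packModP<Suffix>` with CLOSED
instance terms (no local instances: `native_decide` refuses goals with free variables).
-/

namespace Summit.MatrixMultiplication.MatrixMultiplication.Theorems.GradedDesignFamily

open Matrix

set_option maxHeartbeats 20000000 in
set_option maxRecDepth 4000 in
set_option synthInstance.maxHeartbeats 2000000 in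
set_option synthInstance.maxSize 1000000 in
/-- `subfieldCell_pack_modp` SPECIALISED to the model `k = 𝔽₅ = ZMod 5`, `K = 𝔽₂₅ = QuadraticAlgebra (ZMod 5) 2 0`, with NAMED
instance binders so that the assembly below can supply closed instance terms by name, the dual identities in blocks,
and target well-formedness replaced by the SUBFIELD-DETERMINANT TEST `hwf'` (via `subfieldCell_hwf_of_subfieldDetTest`
with the test `im = 0`, passed by all of `algebraMap 𝔽₅ K`).  Pure logic; no computation. -/
theorem subfieldCell_twentyfive_packModPN
    [hp5 : Fact (Nat.Prime 5)]
    [hF : Fact (∀ r : ZMod 5, r ^ 2 ≠ 2 + 0 * r)]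
    [hK : Fintype (QuadraticAlgebra (ZMod 5) 2 0)]
    (h25 : Fintype.card (QuadraticAlgebra (ZMod 5) 2 0) = 25)
    {ny nz m p : ℕ} [hp : Fact p.Prime]
    (yOf : Fin ny → GL (Fin 2) (QuadraticAlgebra (ZMod 5) 2 0)) (zOf : Fin nz → GL (Fin 2) (QuadraticAlgebra (ZMod 5) 2 0))
    (slOf : Fin m → Matrix.SpecialLinearGroup (Fin 2) (ZMod 5)) (rOf : Fin 103 → GL (Fin 2) (QuadraticAlgebra (ZMod 5) 2 0))
    (S : Finset (Fin 2 → QuadraticAlgebra (ZMod 5) 2 0))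
    (hy : Function.Injective yOf) (hz : Function.Injective zOf)
    (hsl : ∀ a ∈ (Finset.univ : Finset (Matrix.SpecialLinearGroup (Fin 2) (ZMod 5))), ∃ n : Fin m, slOf n = a)
    (hcov : ∀ i i' : Fin ny, ∀ l : Fin nz, ∃ c : Fin 103, ∃ n' : Fin m,
        Matrix.SpecialLinearGroup.mapGL (QuadraticAlgebra (ZMod 5) 2 0) (slOf n') * rOf c = yOf i * (yOf i')⁻¹ * zOf l)
    (hwf' : ∀ i i' : Fin ny, ∀ l j : Fin nz,
        (∀ a b : Fin 2, (((zOf j * (yOf i * (yOf i')⁻¹ * zOf l)⁻¹ : GL (Fin 2) (QuadraticAlgebra (ZMod 5) 2 0)) : Matrix (Fin 2) (Fin 2) (QuadraticAlgebra (ZMod 5) 2 0)) a b).im = 0) →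
        Matrix.det (((zOf j * (yOf i * (yOf i')⁻¹ * zOf l)⁻¹ : GL (Fin 2) (QuadraticAlgebra (ZMod 5) 2 0)) : Matrix (Fin 2) (Fin 2) (QuadraticAlgebra (ZMod 5) 2 0))) = 1 →
        yOf i = yOf i' ∧ zOf l = zOf j)
    (hd0 : ∀ c : Fin 21, ∃ b : (Fin 2 → QuadraticAlgebra (ZMod 5) 2 0) → (Fin 2 → QuadraticAlgebra (ZMod 5) 2 0) → ZMod p,
        ∀ n' : Fin m, ∀ c' : Fin 103,
          (let X : Matrix (Fin 2) (Fin 2) (QuadraticAlgebra (ZMod 5) 2 0) :=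
              ((Matrix.SpecialLinearGroup.mapGL (QuadraticAlgebra (ZMod 5) 2 0) (slOf n') * rOf c' : GL (Fin 2) (QuadraticAlgebra (ZMod 5) 2 0)) : Matrix (Fin 2) (Fin 2) (QuadraticAlgebra (ZMod 5) 2 0))
            let x₀₀ : QuadraticAlgebra (ZMod 5) 2 0 := X 0 0
            let x₀₁ : QuadraticAlgebra (ZMod 5) 2 0 := X 0 1
            let x₁₀ : QuadraticAlgebra (ZMod 5) 2 0 := X 1 0
            let x₁₁ : QuadraticAlgebra (ZMod 5) 2 0 := X 1 1
            ∑ u ∈ S, b u (!![x₀₀, x₀₁; x₁₀, x₁₁].mulVec u)) =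
            if Matrix.SpecialLinearGroup.mapGL (QuadraticAlgebra (ZMod 5) 2 0) (slOf n') * rOf c' = rOf (⟨0 + c.val, by have := c.isLt; omega⟩ : Fin 103) then (1 : ZMod p) else 0)
    (hd1 : ∀ c : Fin 21, ∃ b : (Fin 2 → QuadraticAlgebra (ZMod 5) 2 0) → (Fin 2 → QuadraticAlgebra (ZMod 5) 2 0) → ZMod p,
        ∀ n' : Fin m, ∀ c' : Fin 103,
          (let X : Matrix (Fin 2) (Fin 2) (QuadraticAlgebra (ZMod 5) 2 0) :=
              ((Matrix.SpecialLinearGroup.mapGL (QuadraticAlgebra (ZMod 5) 2 0) (slOf n') * rOf c' : GL (Fin 2) (QuadraticAlgebra (ZMod 5) 2 0)) : Matrix (Fin 2) (Fin 2) (QuadraticAlgebra (ZMod 5) 2 0))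
            let x₀₀ : QuadraticAlgebra (ZMod 5) 2 0 := X 0 0
            let x₀₁ : QuadraticAlgebra (ZMod 5) 2 0 := X 0 1
            let x₁₀ : QuadraticAlgebra (ZMod 5) 2 0 := X 1 0
            let x₁₁ : QuadraticAlgebra (ZMod 5) 2 0 := X 1 1
            ∑ u ∈ S, b u (!![x₀₀, x₀₁; x₁₀, x₁₁].mulVec u)) =
            if Matrix.SpecialLinearGroup.mapGL (QuadraticAlgebra (ZMod 5) 2 0) (slOf n') * rOf c' = rOf (⟨21 + c.val, by have := c.isLt; omega⟩ : Fin 103) then (1 : ZMod p) else 0)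
    (hd2 : ∀ c : Fin 21, ∃ b : (Fin 2 → QuadraticAlgebra (ZMod 5) 2 0) → (Fin 2 → QuadraticAlgebra (ZMod 5) 2 0) → ZMod p,
        ∀ n' : Fin m, ∀ c' : Fin 103,
          (let X : Matrix (Fin 2) (Fin 2) (QuadraticAlgebra (ZMod 5) 2 0) :=
              ((Matrix.SpecialLinearGroup.mapGL (QuadraticAlgebra (ZMod 5) 2 0) (slOf n') * rOf c' : GL (Fin 2) (QuadraticAlgebra (ZMod 5) 2 0)) : Matrix (Fin 2) (Fin 2) (QuadraticAlgebra (ZMod 5) 2 0))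
            let x₀₀ : QuadraticAlgebra (ZMod 5) 2 0 := X 0 0
            let x₀₁ : QuadraticAlgebra (ZMod 5) 2 0 := X 0 1
            let x₁₀ : QuadraticAlgebra (ZMod 5) 2 0 := X 1 0
            let x₁₁ : QuadraticAlgebra (ZMod 5) 2 0 := X 1 1
            ∑ u ∈ S, b u (!![x₀₀, x₀₁; x₁₀, x₁₁].mulVec u)) =
            if Matrix.SpecialLinearGroup.mapGL (QuadraticAlgebra (ZMod 5) 2 0) (slOf n') * rOf c' = rOf (⟨42 + c.val, by have := c.isLt; omega⟩ : Fin 103) then (1 : ZMod p) else 0)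
    (hd3 : ∀ c : Fin 21, ∃ b : (Fin 2 → QuadraticAlgebra (ZMod 5) 2 0) → (Fin 2 → QuadraticAlgebra (ZMod 5) 2 0) → ZMod p,
        ∀ n' : Fin m, ∀ c' : Fin 103,
          (let X : Matrix (Fin 2) (Fin 2) (QuadraticAlgebra (ZMod 5) 2 0) :=
              ((Matrix.SpecialLinearGroup.mapGL (QuadraticAlgebra (ZMod 5) 2 0) (slOf n') * rOf c' : GL (Fin 2) (QuadraticAlgebra (ZMod 5) 2 0)) : Matrix (Fin 2) (Fin 2) (QuadraticAlgebra (ZMod 5) 2 0))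
            let x₀₀ : QuadraticAlgebra (ZMod 5) 2 0 := X 0 0
            let x₀₁ : QuadraticAlgebra (ZMod 5) 2 0 := X 0 1
            let x₁₀ : QuadraticAlgebra (ZMod 5) 2 0 := X 1 0
            let x₁₁ : QuadraticAlgebra (ZMod 5) 2 0 := X 1 1
            ∑ u ∈ S, b u (!![x₀₀, x₀₁; x₁₀, x₁₁].mulVec u)) =
            if Matrix.SpecialLinearGroup.mapGL (QuadraticAlgebra (ZMod 5) 2 0) (slOf n') * rOf c' = rOf (⟨63 + c.val, by have := c.isLt; omega⟩ : Fin 103) then (1 : ZMod p) else 0)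
    (hd4 : ∀ c : Fin 19, ∃ b : (Fin 2 → QuadraticAlgebra (ZMod 5) 2 0) → (Fin 2 → QuadraticAlgebra (ZMod 5) 2 0) → ZMod p,
        ∀ n' : Fin m, ∀ c' : Fin 103,
          (let X : Matrix (Fin 2) (Fin 2) (QuadraticAlgebra (ZMod 5) 2 0) :=
              ((Matrix.SpecialLinearGroup.mapGL (QuadraticAlgebra (ZMod 5) 2 0) (slOf n') * rOf c' : GL (Fin 2) (QuadraticAlgebra (ZMod 5) 2 0)) : Matrix (Fin 2) (Fin 2) (QuadraticAlgebra (ZMod 5) 2 0))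
            let x₀₀ : QuadraticAlgebra (ZMod 5) 2 0 := X 0 0
            let x₀₁ : QuadraticAlgebra (ZMod 5) 2 0 := X 0 1
            let x₁₀ : QuadraticAlgebra (ZMod 5) 2 0 := X 1 0
            let x₁₁ : QuadraticAlgebra (ZMod 5) 2 0 := X 1 1
            ∑ u ∈ S, b u (!![x₀₀, x₀₁; x₁₀, x₁₁].mulVec u)) =
            if Matrix.SpecialLinearGroup.mapGL (QuadraticAlgebra (ZMod 5) 2 0) (slOf n') * rOf c' = rOf (⟨84 + c.val, by have := c.isLt; omega⟩ : Fin 103) then (1 : ZMod p) else 0) :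
    ∃ (k K : Type) (_ : Field k) (_ : Fintype k) (_ : DecidableEq k)
      (_ : Field K) (_ : Fintype K) (_ : DecidableEq K)
      (φ : Matrix.SpecialLinearGroup (Fin 2) k →* Matrix.GeneralLinearGroup (Fin 2) K),
      Function.Injective φ ∧ Fintype.card K = Fintype.card k ^ 2 ∧ Fintype.card K = 25 ∧
      ∃ Y Z : Finset (Matrix.GeneralLinearGroup (Fin 2) K),
        Y.card = ny ∧ Z.card = nz ∧
        ∀ z₀ ∈ Z, ∃ cf : (Fin 2 → K) → (Fin 2 → K) → ℂ,
          ∀ a : Matrix.SpecialLinearGroup (Fin 2) k, ∀ y ∈ Y, ∀ y' ∈ Y, ∀ z ∈ Z,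
            (∑ u : Fin 2 → K, cf u (((φ a * y * y'⁻¹ * z : Matrix.GeneralLinearGroup (Fin 2) K) :
                Matrix (Fin 2) (Fin 2) K).mulVec u)) =
              if a = 1 ∧ y = y' ∧ z = z₀ then 1 else 0 :=
  subfieldCell_pack_modp (k := ZMod 5) (K := QuadraticAlgebra (ZMod 5) 2 0) (by rw [h25, ZMod.card]; norm_num) h25 yOf zOf slOf rOf S hy hz
    (fun a => hsl a (Finset.mem_univ a)) hcov
    (subfieldCell_hwf_of_subfieldDetTest (k := ZMod 5) (K := QuadraticAlgebra (ZMod 5) 2 0) QuadraticAlgebra.algebraMap_injective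
      (fun x => x.im = 0) (fun x => QuadraticAlgebra.algebraMap_im x) yOf zOf slOf hwf')
    (fun c => by
      obtain ⟨c, hc⟩ := c
      rcases Nat.lt_or_ge c 21 with h0 | h0
      · obtain ⟨d, rfl⟩ : ∃ d, c = 0 + d := ⟨c - 0, by omega⟩
        exact hd0 ⟨d, by omega⟩
      rcases Nat.lt_or_ge c 42 with h1 | h1
      · obtain ⟨d, rfl⟩ : ∃ d, c = 21 + d := ⟨c - 21, by omega⟩
        exact hd1 ⟨d, by omega⟩
      rcases Nat.lt_or_ge c 63 with h2 | h2
      · obtain ⟨d, rfl⟩ : ∃ d, c = 42 + d := ⟨c - 42, by omega⟩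
        exact hd2 ⟨d, by omega⟩
      rcases Nat.lt_or_ge c 84 with h3 | h3
      · obtain ⟨d, rfl⟩ : ∃ d, c = 63 + d := ⟨c - 63, by omega⟩
        exact hd3 ⟨d, by omega⟩
      · obtain ⟨d, rfl⟩ : ∃ d, c = 84 + d := ⟨c - 84, by omega⟩
        exact hd4 ⟨d, by omega⟩)

set_option maxHeartbeats 20000000 in
set_option maxRecDepth 4000 in
set_option synthInstance.maxHeartbeats 2000000 in
set_option synthInstance.maxSize 1000000 in
/-- The explicit list of `SL₂(𝔽₅)` (120 matrices) is exhaustive (`native_decide`). -/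
theorem subfieldCell_twentyfive_hslN :
    ∀ a ∈ (Finset.univ : Finset (Matrix.SpecialLinearGroup (Fin 2) (ZMod 5))), ∃ n : Fin 120, subfieldCell_twentyfive_slN n = a := by
  native_decide

set_option maxHeartbeats 20000000 in
set_option maxRecDepth 4000 in
set_option synthInstance.maxHeartbeats 2000000 in
set_option synthInstance.maxSize 1000000 in
/-- Coset cover, tabulated: for every `(i, i', l)` the point `y_i y_i'⁻¹ z_l` equals
`φ(h_{N(i,i',l)}) · r_{C(i,i',l)}` for the explicit index tables `C`, `N` (103 identities, one `native_decide`). -/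
theorem subfieldCell_twentyfive_hcovN_table :
    let C : Fin 1 → Fin 1 → Fin 103 → Fin 103 :=
      (fun (i i' : Fin 1) (l : Fin 103) =>
        ([0, 1, 2, 3, 4, 5, 6, 7, 8, 9, 10, 11, 12, 13, 14, 15, 16, 17, 18, 19, 20, 21, 22, 23, 24, 25, 26, 27, 28, 29, 30, 31,
          32, 33, 34, 35, 36, 37, 38, 39, 40, 41, 42, 43, 44, 45, 46, 47, 48, 49, 50, 51, 52, 53, 54, 55, 56, 57, 58, 59, 60, 61, 62, 63,
          64, 65, 66, 67, 68, 69, 70, 71, 72, 73, 74, 75, 76, 77, 78, 79, 80, 81, 82, 83, 84, 85, 86, 87, 88, 89, 90, 91, 92, 93, 94, 95,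
          96, 97, 98, 99, 100, 101, 102] : List (Fin 103)).getD ((1 * i.val + i'.val) * 103 + l.val) 0)
    let N : Fin 1 → Fin 1 → Fin 103 → Fin 120 :=
      (fun (i i' : Fin 1) (l : Fin 103) =>
        ([0, 0, 0, 0, 0, 0, 0, 0, 0, 0, 0, 0, 0, 0, 0, 0, 0, 0, 0, 0, 0, 0, 0, 0, 0, 0, 0, 0, 0, 0, 0, 0,
          0, 0, 0, 0, 0, 0, 0, 0, 0, 0, 0, 0, 0, 0, 0, 0, 0, 0, 0, 0, 0, 0, 0, 0, 0, 0, 0, 0, 0, 0, 0, 0,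
          0, 0, 0, 0, 0, 0, 0, 0, 0, 0, 0, 0, 0, 0, 0, 0, 0, 0, 0, 0, 0, 0, 0, 0, 0, 0, 0, 0, 0, 0, 0, 0,
          0, 0, 0, 0, 0, 0, 0] : List (Fin 120)).getD ((1 * i.val + i'.val) * 103 + l.val) 0)
    ∀ i i' : Fin 1, ∀ l : Fin 103,
      Matrix.SpecialLinearGroup.mapGL (QuadraticAlgebra (ZMod 5) 2 0) (subfieldCell_twentyfive_slN (N i i' l)) * subfieldCell_twentyfive_repsN (C i i' l) = subfieldCell_twentyfive_yN i * (subfieldCell_twentyfive_yN i')⁻¹ * subfieldCell_twentyfive_zN l := by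
  native_decide

set_option maxHeartbeats 20000000 in
set_option maxRecDepth 4000 in
set_option synthInstance.maxHeartbeats 2000000 in
set_option synthInstance.maxSize 1000000 in
/-- Coset cover (hypothesis `hcov` of the pack lemma): every point of `Y Y⁻¹ Z` lies in one of the 103 listed
cosets of `φ(SL₂ 𝔽₅)`. -/
theorem subfieldCell_twentyfive_hcovN :
    ∀ i i' : Fin 1, ∀ l : Fin 103, ∃ c : Fin 103, ∃ n' : Fin 120,
      Matrix.SpecialLinearGroup.mapGL (QuadraticAlgebra (ZMod 5) 2 0) (subfieldCell_twentyfive_slN n') * subfieldCell_twentyfive_repsN c = subfieldCell_twentyfive_yN i * (subfieldCell_twentyfive_yN i')⁻¹ * subfieldCell_twentyfive_zN l :=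
  fun i i' l => ⟨_, _, subfieldCell_twentyfive_hcovN_table i i' l⟩

set_option maxHeartbeats 20000000 in
set_option maxRecDepth 4000 in
set_option synthInstance.maxHeartbeats 2000000 in
set_option synthInstance.maxSize 1000000 in
/-- The subfield-determinant test behind target well-formedness (hypothesis `hwf'` of the wrapper):
`z_j (y_i y_i'⁻¹ z_l)⁻¹` has all four entries in `𝔽₅` (imaginary parts `0`) and determinant `1` only for `i = i'`,
`l = j` (10609 cases, one `native_decide`; 8 quotients lie in `GL₂(𝔽₅) ∖ SL₂(𝔽₅)`). -/
theorem subfieldCell_twentyfive_hwfN :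
    ∀ i i' : Fin 1, ∀ l j : Fin 103,
      (∀ a b : Fin 2, (((subfieldCell_twentyfive_zN j * (subfieldCell_twentyfive_yN i * (subfieldCell_twentyfive_yN i')⁻¹ * subfieldCell_twentyfive_zN l)⁻¹ : GL (Fin 2) (QuadraticAlgebra (ZMod 5) 2 0)) : Matrix (Fin 2) (Fin 2) (QuadraticAlgebra (ZMod 5) 2 0)) a b).im = 0) →
      Matrix.det (((subfieldCell_twentyfive_zN j * (subfieldCell_twentyfive_yN i * (subfieldCell_twentyfive_yN i')⁻¹ * subfieldCell_twentyfive_zN l)⁻¹ : GL (Fin 2) (QuadraticAlgebra (ZMod 5) 2 0)) : Matrix (Fin 2) (Fin 2) (QuadraticAlgebra (ZMod 5) 2 0))) = 1 →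
      subfieldCell_twentyfive_yN i = subfieldCell_twentyfive_yN i' ∧ subfieldCell_twentyfive_zN l = subfieldCell_twentyfive_zN j := by
  native_decide

set_option maxHeartbeats 20000000 in
set_option maxRecDepth 4000 in
set_option synthInstance.maxHeartbeats 2000000 in
set_option synthInstance.maxSize 1000000 in
/-- **TRUE instance of the subfield-cell clause at `|K| = 25` with `|Y| = 1`, `|Z| = 103`** (binder structure of
`stub_subfieldCell` with the asymptotic prefix replaced by the concrete cardinalities; mod-`2` dual certificate
through `subfieldCell_pack_modp`; certificate, not summit progress). -/
theorem subfieldCell_twentyfive_witnessN :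
    ∃ (k K : Type) (_ : Field k) (_ : Fintype k) (_ : DecidableEq k)
      (_ : Field K) (_ : Fintype K) (_ : DecidableEq K)
      (φ : Matrix.SpecialLinearGroup (Fin 2) k →* Matrix.GeneralLinearGroup (Fin 2) K),
      Function.Injective φ ∧ Fintype.card K = Fintype.card k ^ 2 ∧ Fintype.card K = 25 ∧
      ∃ Y Z : Finset (Matrix.GeneralLinearGroup (Fin 2) K),
        Y.card = 1 ∧ Z.card = 103 ∧
        ∀ z₀ ∈ Z, ∃ cf : (Fin 2 → K) → (Fin 2 → K) → ℂ,
          ∀ a : Matrix.SpecialLinearGroup (Fin 2) k, ∀ y ∈ Y, ∀ y' ∈ Y, ∀ z ∈ Z,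
            (∑ u : Fin 2 → K, cf u (((φ a * y * y'⁻¹ * z : Matrix.GeneralLinearGroup (Fin 2) K) :
                Matrix (Fin 2) (Fin 2) K).mulVec u)) =
              if a = 1 ∧ y = y' ∧ z = z₀ then 1 else 0 :=
  subfieldCell_twentyfive_packModPN
    (hp5 := ⟨by norm_num⟩)
    (hF := ⟨by decide⟩)
    (hK := (Fintype.ofEquiv _ (QuadraticAlgebra.equivProd (2 : ZMod 5) 0).symm : Fintype (QuadraticAlgebra (ZMod 5) 2 0)))
    (h25 := rfl) (p := 2) (hp := ⟨by norm_num⟩)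
    subfieldCell_twentyfive_yN subfieldCell_twentyfive_zN subfieldCell_twentyfive_slN subfieldCell_twentyfive_repsN subfieldCell_twentyfive_linesN
    (by decide) (by native_decide) subfieldCell_twentyfive_hslN subfieldCell_twentyfive_hcovN subfieldCell_twentyfive_hwfN
    subfieldCell_twentyfive_dualsN0 subfieldCell_twentyfive_dualsN1 subfieldCell_twentyfive_dualsN2 subfieldCell_twentyfive_dualsN3 subfieldCell_twentyfive_dualsN4

end Summit.MatrixMultiplication.MatrixMultiplication.Theorems.GradedDesignFamily
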